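import Literature.NumberTheory.GaloisRepresentations.ContinuousShapiroLiftMackeyCup
import Literature.NumberTheory.GaloisRepresentations.ContinuousH1CoefficientTransport
import Literature.NumberTheory.GaloisRepresentations.ContinuousShapiroLiftCores
import HarnessLib

/-!
# Mackey's decomposition of a restricted coinduced module as an ISOMORPHISM, at module level and on `H¹`:
# `(Maps(G⧸N, X))|_θ ≃+ (ι → Maps(D⧸N_D, X|_θ))`, `H¹(D, (Maps(G⧸N, X))|_θ) ≃+ (ι → H¹(D, Maps(D⧸N_D, X|_θ)))`, and the semi-local count

Topic `NumberTheory/GaloisRepresentations` (namespace = path). Companion of `ContinuousShapiroLiftMackeyCup.lean` (the twisted comparison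
maps `Φ_c = resCoindFinHomR X N θ c : (Maps(G⧸N, X))|_θ ⟶ Maps(D⧸N_D, X|_θ)`, `N_D = θ⁻¹N`) and `ContinuousShapiroLiftMackeyH1.lean` (joint
bijectivity of the `Φ_{g_i}` at module level, joint SURJECTIVITY on `H¹` by cocycle gluing, orbit representatives `exists_orbitReps_bijective`).
Here the same decomposition is packaged as additive EQUIVALENCES — so that INJECTIVITY on `H¹` ("a class of the restricted coinduced
module vanishes iff all its Mackey coordinates do") and the COUNT come for free — for a continuous `θ : D →ₜ* G`, `N ⊴ G` normal, and
ANY family of cosets `c : ι → G ⧸ N` with `hbij : (i, y') ↦ θ̄(y')·c_i` bijective (`{c_i}` = representatives of the `D`-orbits on `G ⧸ N`;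
for `G = Γ_K`, `D = Γ_{K_v}`, `N = Γ_L`: the places of `L` above `v`):

* §1 `mackeyCoordEquiv : (Maps(G⧸N, X))|_θ ≃+ (ι → Maps(D⧸N_D, X|_θ))`, `F ↦ (Φ_{c_i} F)_i`, continuous both ways, `D`-equivariant;
* §2 `mackeyCohomologyEquiv : H¹(D, (Maps(G⧸N, X))|_θ) ≃+ (ι → H¹(D, Maps(D⧸N_D, X|_θ)))` with coordinates `H¹(Φ_{c_i})` (the tree's
  `cohomologyCoordEquiv` of `ContinuousH1CoefficientTransport.lean` fed with §1); `exists_eq_cohomologyMap_resCoindFinHomR` (surjectivity,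
  coset form), **`eq_zero_iff_forall_cohomologyMap_resCoindFinHomR`** (injectivity), `exists_eq_shapiroLift_family` (with the Shapiro
  bijection per orbit: the literature's `H¹(K_v, Ind M) ≅ ⊕_{w ∣ v} H¹(L_w, M)`), `cohomologyMap_resCoindFinHomR_map_id` (compatibility with
  restriction of global classes);
* §3 `natCard_continuousCohomology_res_coindFin_eq_prod`: `#H¹(D, (Maps(G⧸N, X))|_θ) = ∏_i #H¹(N_D, X|_θ)`.

Typed and kernel-checked first in the crux sketch `Summits/BirchSwinnertonDyer/…/Cruxes/ResidualThetaCountLowerPureAtTwo/Sketch_sidea_k2_g12.lean`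
§A/§B/§D (stub-ideation k2 g12, cell `bsd-wall`, crux RSL_g of `Summits/BirchSwinnertonDyer`); landed verbatim (§C there = the tree's
`cupProduct_restrict_coindFin_eq_sum_orbits`, §F = `exists_orbitReps_bijective`). Nothing about BSD is proved here.

## References
* K. S. Brown, *Cohomology of Groups* (1982), III §5 (5.6)(b) (restriction of induced modules: the double coset formula). [Brown1982]
* J. Neukirch, A. Schmidt, K. Wingberg, *Cohomology of Number Fields*, 2nd ed. (2008), I §5 (1.5.6)–(1.5.7) (double cosets), I §6 Prop.
  (1.6.4) (Shapiro's lemma). [NeukirchSchmidtWingberg2008]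
* J.-P. Serre, *Galois Cohomology* (1997), I §2.2, I §2.5. [SerreGaloisCohomology1997]
-/

noncomputable section

open CategoryTheory

open scoped Classical

universe u v

namespace Literature.NumberTheory.GaloisRepresentations

open _root_.TopRep

variable {R : Type u} [CommRing R] [TopologicalSpace R]
variable {G : Type v} [Group G] [TopologicalSpace G]
variable {D : Type v} [Group D] [TopologicalSpace D]

/-! ## §1 Mackey's decomposition at module level: `(Maps(G⧸N, X))|_θ ≃+ (ι → Maps(D⧸N_D, X|_θ))` -/

section ModuleLevel

variable (X : TopRep.{v} R G) (N : Subgroup G) [N.Normal] (θ : D →ₜ* G) {ι : Type v} (c : ι → G ⧸ N)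
  (hbij : Function.Bijective fun q : ι × (D ⧸ N.comap (θ : D →* G)) => quotientMapOfHom N θ q.2 * c q.1)

/-- **Mackey coordinates.** `F ↦ (Φ_{c_i} F)_i` is an additive bijection
`(Maps(G⧸N, X))|_θ ≃+ (ι → Maps(D⧸N_D, X|_θ))` when the `c_i` represent the `D`-orbits of `G ⧸ N`; the inverse reads a
family `Ψ` back through the orbit bijection `e : ι × (D⧸N_D) ≃ G⧸N`, `y ↦ Ψ (e⁻¹ y).1 (e⁻¹ y).2`.
[cite: Brown1982, III §5 (5.6)(b)] [cite: NeukirchSchmidtWingberg2008, I §5 (1.5.6)–(1.5.7)] -/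
def mackeyCoordEquiv :
    TopRep.res (θ : D →* G) (coindFin X N) ≃+ (ι → coindFin (TopRep.res (θ : D →* G) X) (N.comap (θ : D →* G))) where
  toFun F i := (resCoindFinHomR X N θ (c i)).hom F
  invFun Ψ := fun y => Ψ ((Equiv.ofBijective _ hbij).symm y).1 ((Equiv.ofBijective _ hbij).symm y).2
  left_inv F := by
    funext y
    change F (quotientMapOfHom N θ ((Equiv.ofBijective _ hbij).symm y).2 * c ((Equiv.ofBijective _ hbij).symm y).1) = F y
    exact congrArg F ((Equiv.ofBijective _ hbij).apply_symm_apply y)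
  right_inv Ψ := by
    funext i y'
    have h : (Equiv.ofBijective _ hbij).symm (quotientMapOfHom N θ y' * c i) = (i, y') :=
      (Equiv.ofBijective _ hbij).injective (by rw [Equiv.apply_symm_apply, Equiv.ofBijective_apply])
    change Ψ ((Equiv.ofBijective _ hbij).symm (quotientMapOfHom N θ y' * c i)).1
        ((Equiv.ofBijective _ hbij).symm (quotientMapOfHom N θ y' * c i)).2 = Ψ i y'
    rw [h]
  map_add' F F' := funext fun i => map_add _ F F'

/-- Coordinates of `mackeyCoordEquiv`: the `i`-th one is `Φ_{c_i}`. [cite: Brown1982, III §5 (5.6)(b)] -/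
@[simp]
theorem mackeyCoordEquiv_apply (F : TopRep.res (θ : D →* G) (coindFin X N)) (i : ι) :
    mackeyCoordEquiv X N θ c hbij F i = (resCoindFinHomR X N θ (c i)).hom F :=
  rfl

/-- `mackeyCoordEquiv` is continuous (each coordinate is the continuous map `Φ_{c_i}`). [cite: Brown1982, III §5 (5.6)(b)] -/
theorem continuous_mackeyCoordEquiv : Continuous (mackeyCoordEquiv X N θ c hbij) :=
  continuous_pi fun i => (resCoindFinHomR X N θ (c i)).hom.continuous

/-- The inverse of `mackeyCoordEquiv` is continuous (product topologies; evaluation maps). [cite: Brown1982, III §5 (5.6)(b)] -/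
theorem continuous_mackeyCoordEquiv_symm : Continuous (mackeyCoordEquiv X N θ c hbij).symm :=
  continuous_pi fun y =>
    (continuous_apply ((Equiv.ofBijective _ hbij).symm y).2).comp
      (continuous_apply ((Equiv.ofBijective _ hbij).symm y).1)

/-- `mackeyCoordEquiv` is `D`-equivariant coordinatewise (each `Φ_{c_i}` intertwines). [cite: Brown1982, III §5 (5.6)(b)] -/
theorem mackeyCoordEquiv_ρ (d : D) (F : TopRep.res (θ : D →* G) (coindFin X N)) (i : ι) :
    mackeyCoordEquiv X N θ c hbij ((TopRep.res (θ : D →* G) (coindFin X N)).ρ d F) i =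
      (coindFin (TopRep.res (θ : D →* G) X) (N.comap (θ : D →* G))).ρ d (mackeyCoordEquiv X N θ c hbij F i) :=
  TopRep.hom_comm_apply (resCoindFinHomR X N θ (c i)) d F

end ModuleLevel

/-! ## §2 The semi-local decomposition of `H¹`: Mackey at `H¹` as an ISOMORPHISM (surjective AND injective) -/

section CohomologyLevel

variable [IsTopologicalGroup D]
variable (X : TopRep.{v} R G) (N : Subgroup G) [N.Normal] (θ : D →ₜ* G) {ι : Type v} (c : ι → G ⧸ N)
  (hbij : Function.Bijective fun q : ι × (D ⧸ N.comap (θ : D →* G)) => quotientMapOfHom N θ q.2 * c q.1)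

/-- **Mackey at the level of `H¹`**: `H¹(D, (Maps(G⧸N, X))|_θ) ≃+ (ι → H¹(D, Maps(D⧸N_D, X|_θ)))`, the tree's
`cohomologyCoordEquiv` for the coordinate system of §1. [cite: NeukirchSchmidtWingberg2008, I §5 (1.5.6)–(1.5.7)]
[cite: SerreGaloisCohomology1997, I §2.2] -/
def mackeyCohomologyEquiv :
    continuousCohomology.{u, v, v} 1 (TopRep.res (θ : D →* G) (coindFin X N)) ≃+
      (ι → continuousCohomology.{u, v, v} 1 (coindFin (TopRep.res (θ : D →* G) X) (N.comap (θ : D →* G)))) :=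
  cohomologyCoordEquiv (X := coindFin (TopRep.res (θ : D →* G) X) (N.comap (θ : D →* G)))
    (X₁ := TopRep.res (θ : D →* G) (coindFin X N)) (mackeyCoordEquiv X N θ c hbij)
    (continuous_mackeyCoordEquiv X N θ c hbij) (continuous_mackeyCoordEquiv_symm X N θ c hbij)
    (mackeyCoordEquiv_ρ X N θ c hbij)

/-- The coordinates of `mackeyCohomologyEquiv` are the maps `H¹(Φ_{c_i})` (`cohomologyMap (resCoindFinHomR …) 1`).
[cite: NeukirchSchmidtWingberg2008, I §5 (1.5.6)–(1.5.7)] -/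
theorem mackeyCohomologyEquiv_apply (z : continuousCohomology.{u, v, v} 1 (TopRep.res (θ : D →* G) (coindFin X N))) (i : ι) :
    mackeyCohomologyEquiv X N θ c hbij z i = cohomologyMap (resCoindFinHomR X N θ (c i)) 1 z := by
  obtain ⟨φ, rfl⟩ := oneCocycleClass_surjective _ z
  unfold mackeyCohomologyEquiv
  rw [cohomologyCoordEquiv_apply, cohomologyCoord_oneCocycleClass, cohomologyMap_oneCocycleClass]
  exact congrArg _ (Subtype.ext (ContinuousMap.ext fun d => rfl))

include hbij in
/-- **Surjectivity in the form the `SelmerComplement` step (S4₀ `hne`) consumes**: every family of local layer classes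
`(t_i)_i`, `t_i ∈ H¹(D, Maps(D⧸N_D, X|_θ))`, is the family of Mackey coordinates of ONE class of the restricted coinduced
module. [cite: NeukirchSchmidtWingberg2008, I §5 (1.5.6)–(1.5.7)] -/
theorem exists_eq_cohomologyMap_resCoindFinHomR
    (t : ι → continuousCohomology.{u, v, v} 1 (coindFin (TopRep.res (θ : D →* G) X) (N.comap (θ : D →* G)))) :
    ∃ z : continuousCohomology.{u, v, v} 1 (TopRep.res (θ : D →* G) (coindFin X N)),
      ∀ i, cohomologyMap (resCoindFinHomR X N θ (c i)) 1 z = t i := by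
  obtain ⟨z, hz⟩ := (mackeyCohomologyEquiv X N θ c hbij).surjective t
  exact ⟨z, fun i => by rw [← mackeyCohomologyEquiv_apply X N θ c hbij, hz]⟩

include hbij in
/-- **Injectivity**: a class of the restricted coinduced module vanishes iff all its Mackey coordinates do.
[cite: NeukirchSchmidtWingberg2008, I §5 (1.5.6)–(1.5.7)] -/
theorem eq_zero_iff_forall_cohomologyMap_resCoindFinHomR
    (z : continuousCohomology.{u, v, v} 1 (TopRep.res (θ : D →* G) (coindFin X N))) :
    z = 0 ↔ ∀ i, cohomologyMap (resCoindFinHomR X N θ (c i)) 1 z = 0 := by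
  rw [← (mackeyCohomologyEquiv X N θ c hbij).map_eq_zero_iff, funext_iff]
  exact forall_congr' fun i => by rw [mackeyCohomologyEquiv_apply]; rfl

include hbij in
/-- **The SEMI-LOCAL SHAPIRO decomposition** `H¹(D, (Maps(G⧸N, X))|_θ) ≅ ⊕_{i} H¹(N_D, X|_θ)`: every family of
LAYER classes `a_i ∈ H¹(N_D, X|_θ)` is `(Sh_{N_D}^D)⁻¹` of the Mackey coordinates of one class (§2 + `shapiroLift_surjective`);
dictionary: `D = Γ_{ℚ_ℓ}`, `G = Γ_ℚ`, `N = Γ_{ℚ_n}`, `N_D = Γ_{ℚ_{n,𝔩}}`, `ι` = places of `ℚ_n` above `ℓ`, i.e. the literature's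
`H¹(ℚ_ℓ, Ind M) = ⊕_{𝔩∣ℓ} H¹(ℚ_{n,𝔩}, M)`. [cite: NeukirchSchmidtWingberg2008, I §6 Prop. (1.6.4)] -/
theorem exists_eq_shapiroLift_family (hN : IsOpen (N : Set G))
    {sD : D ⧸ N.comap (θ : D →* G) → D} (hsD : ∀ y, (sD y : D ⧸ N.comap (θ : D →* G)) = y)
    (hsD1 : sD ((1 : D) : D ⧸ N.comap (θ : D →* G)) = 1)
    (a : ι → continuousCohomology.{u, v, v} 1 (subgroupRep (TopRep.res (θ : D →* G) X) (N.comap (θ : D →* G)))) :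
    ∃ z : continuousCohomology.{u, v, v} 1 (TopRep.res (θ : D →* G) (coindFin X N)),
      ∀ i, cohomologyMap (resCoindFinHomR X N θ (c i)) 1 z =
        shapiroLift (TopRep.res (θ : D →* G) X) (N.comap (θ : D →* G)) (isOpen_comap N θ hN) hsD hsD1 (a i) :=
  exists_eq_cohomologyMap_resCoindFinHomR X N θ c hbij _

/-- **Compatibility with restriction of GLOBAL classes** (the bridge to `ContinuousShapiroLiftMackeyCup` §3/§5): the `i`-th Mackey coordinate of the
restriction `θ^* x` of a global class `x ∈ H¹(G, Maps(G⧸N, X))` is `H¹(θ, Φ_{c_i}) x`; for `x = Sh_N^G a` this is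
`Sh_{N_D}^D(θ_N^*(g_i · a))` by the landed `map_resCoindFinHomR_shapiroLift`. [cite: NeukirchSchmidtWingberg2008, I §5 (1.5.6)–(1.5.7)] -/
theorem cohomologyMap_resCoindFinHomR_map_id [IsTopologicalGroup G] (x : continuousCohomology.{u, v, v} 1 (coindFin X N)) (i : ι) :
    cohomologyMap (resCoindFinHomR X N θ (c i)) 1
        (ContinuousCohomology.map θ (𝟙 (TopRep.res (θ : D →* G) (coindFin X N))) 1 x) =
      ContinuousCohomology.map θ (resCoindFinHomR X N θ (c i)) 1 x := by
  obtain ⟨φ, rfl⟩ := oneCocycleClass_surjective _ x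
  rw [map_oneCocycleClass, map_oneCocycleClass, map_oneCocycleClass]
  exact congrArg _ (Subtype.ext (ContinuousMap.ext fun d => rfl))

end CohomologyLevel

/-! ## §3 The semi-local COUNT `#H¹(D, (Maps(G⧸N, X))|_θ) = ∏_i #H¹(N_D, X|_θ)` -/

section Count

variable [IsTopologicalGroup D]
variable (X : TopRep.{v} R G) (N : Subgroup G) [N.Normal] (θ : D →ₜ* G) {ι : Type v} [Fintype ι] (c : ι → G ⧸ N)

/-- **The semi-local COUNT** `#H¹(D, (Maps(G⧸N, X))|_θ) = ∏_i #H¹(N_D, X|_θ)` for orbit representatives `c` (Mackey `H¹`-coordinates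
`mackeyCohomologyEquiv` + the degree-one Shapiro bijection `shapiroLift_injective/_surjective` per orbit; both sides may be infinite, then
both `Nat.card`s are `0`-conventions of the same cardinal). Dictionary: Greenberg LNM 1716 §4, `𝒫^{(v)}(F_n) = ∏_{v_n ∣ v} ℋ((F_n)_{v_n})`;
the literature's `H¹(K_v, Ind M) ≅ ⊕_{w∣v} H¹(L_w, M)`. [cite: NeukirchSchmidtWingberg2008, I §5 (1.5.6), I §6 (1.6.4)] -/
theorem natCard_continuousCohomology_res_coindFin_eq_prod
    (hbij : Function.Bijective fun q : ι × (D ⧸ N.comap (θ : D →* G)) => quotientMapOfHom N θ q.2 * c q.1)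
    (hN : IsOpen (N : Set G)) :
    Nat.card (continuousCohomology.{u, v, v} 1 (TopRep.res (θ : D →* G) (coindFin X N))) =
      ∏ _i : ι, Nat.card (continuousCohomology.{u, v, v} 1 (subgroupRep (TopRep.res (θ : D →* G) X) (N.comap (θ : D →* G)))) := by
  classical
  let sD : D ⧸ N.comap (θ : D →* G) → D := fun y =>
    if y = ((1 : D) : D ⧸ N.comap (θ : D →* G)) then 1 else Quotient.out y
  have hsD : ∀ y, (sD y : D ⧸ N.comap (θ : D →* G)) = y := fun y => by
    by_cases hy : y = ((1 : D) : D ⧸ N.comap (θ : D →* G))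
    · subst hy
      simp only [sD, if_true, QuotientGroup.mk_one]
    · simp only [sD, if_neg hy]
      exact QuotientGroup.out_eq' y
  have hsD1 : sD ((1 : D) : D ⧸ N.comap (θ : D →* G)) = 1 := by simp only [sD, if_pos rfl]
  rw [Nat.card_congr (mackeyCohomologyEquiv X N θ c hbij).toEquiv, Nat.card_pi]
  refine Finset.prod_congr rfl fun i _ => ?_
  exact (Nat.card_congr (Equiv.ofBijective _
    ⟨shapiroLift_injective (TopRep.res (θ : D →* G) X) (N.comap (θ : D →* G)) (isOpen_comap N θ hN) hsD hsD1,
      shapiroLift_surjective (TopRep.res (θ : D →* G) X) (N.comap (θ : D →* G)) (isOpen_comap N θ hN) hsD hsD1⟩)).symm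

end Count

end Literature.NumberTheory.GaloisRepresentations

end
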